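import Mathlib.Analysis.Asymptotics.Lemmas
import Mathlib.Analysis.Complex.Basic
import Summits.MatrixMultiplication.MatrixMultiplication.Theses.HessianPlane
import Literature.Computability.AlgebraicComplexity.TensorRestrictionRank
import Literature.Computability.AlgebraicComplexity.GroupAlgebraTensor

/-!
# MatrixMultiplication / HessianPlane — support `HesseToCW` (stmt-MatrixMultiplication-4895)

The CW point of route HessianPlane: flatness of asymptotic rank on the Hessian plane
(`HessianPlaneFlat`) implies the growth bound `R(T_cw,2^{⊠N}) = O(3^{(1+ε)N})` for the small
Coppersmith–Winograd tensor `T_cw,2 = Σ_{i=1,2} (e₀eᵢeᵢ + eᵢe₀eᵢ + eᵢeᵢe₀)` (the `BThesis` of route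
AsymptoticRankCW, inlined in `∏`-form), i.e. the route decl
`Summit.MatrixMultiplication.MatrixMultiplication.Theses.HessianPlane.HesseToCW`.

Proof. Instantiate `HessianPlaneFlat` at `(a,b,c) = (0,1,1)`: the plane point
`u(0,1,1)(x,y,z) = [x+y+z ≡ 0]·![0,1,1](y−x)` is the indicator `P` of the six permutations
`{x,y,z} = {0,1,2}` (cubic form `6x₀x₁x₂`).  With `M = [[1,0,0],[0,1,1],[0,i,−i]]` one has
`T_cw,2 = (½M ⊗ M ⊗ M)·P` entrywise (cubic forms `6x₀x₁x₂ ↦ 3x₀(x₁²+x₂²)`), i.e. `P ≥ T_cw,2` in the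
restriction preorder (`TensorRestrictsTo`, a 27-entry check), hence `P^{⊠N} ≥ T_cw,2^{⊠N}`
(`TensorRestrictsTo.kroneckerPow`) and `R(T_cw,2^{⊠N}) ≤ R(P^{⊠N})`
(`TensorRestrictsTo.tensorRank_le`) for every `N`; the `O(3^{(1+ε)N})` bound transfers
(`Asymptotics.isBigO_of_le`).  Complex scalars are needed: the pencil determinants
`−ξ₀(ξ₁²+ξ₂²)` of `T_cw,2` and `2ξ₀ξ₁ξ₂` of `P` are not `GL₃(ℝ)`-equivalent.
-/

-- The Theorems namespace repeats `MatrixMultiplication` (summit = sub-problem), which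
-- `linter.dupNamespace` would flag.
set_option linter.dupNamespace false

noncomputable section

open Filter Asymptotics
open scoped BigOperators

namespace Summit.MatrixMultiplication.MatrixMultiplication.Theorems

open Literature.Computability.AlgebraicComplexity

/-- Contracting against the plane point `u(0,1,1)` (the indicator of the six permutations of
`(0,1,2)`) leaves the six permutation terms. [folklore] -/
theorem sum_mul_hessePointCW (g : Fin 3 → Fin 3 → Fin 3 → ℂ) :
    ∑ p, ∑ q, ∑ r, g p q r *
        (fun x y z : Fin 3 => if x + y + z = 0 then ![(0 : ℂ), 1, 1] (y - x) else (0 : ℂ)) p q r =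
      g 0 1 2 + g 0 2 1 + g 1 0 2 + g 1 2 0 + g 2 0 1 + g 2 1 0 := by
  simp [Fin.sum_univ_three, add_assoc]

/-- `u(0,1,1) ≥ T_cw,2` in the restriction preorder: `T_cw,2 = (½M ⊗ M ⊗ M)·u(0,1,1)` with
`M = [[1,0,0],[0,1,1],[0,i,−i]]` (AlmanLi2026 §7.1: `cw₂′ ≅ T_cw,2` over `ℂ`). [folklore] -/
theorem hessePointCW_restrictsTo_cwTwo :
    TensorRestrictsTo
      (fun x y z : Fin 3 => if x + y + z = 0 then ![(0 : ℂ), 1, 1] (y - x) else (0 : ℂ))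
      (fun a b c : Fin 3 => if (a = 0 ∧ b = c ∧ b ≠ 0) ∨ (b = 0 ∧ a = c ∧ a ≠ 0) ∨
        (c = 0 ∧ a = b ∧ a ≠ 0) then (1 : ℂ) else 0) := by
  refine ⟨fun x p => (1 / 2 : ℂ) * ![![(1 : ℂ), 0, 0], ![0, 1, 1], ![0, Complex.I, -Complex.I]] x p,
    fun x p => ![![(1 : ℂ), 0, 0], ![0, 1, 1], ![0, Complex.I, -Complex.I]] x p,
    fun x p => ![![(1 : ℂ), 0, 0], ![0, 1, 1], ![0, Complex.I, -Complex.I]] x p, fun x y z => ?_⟩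
  rw [sum_mul_hessePointCW (fun p q r =>
    (1 / 2 : ℂ) * ![![(1 : ℂ), 0, 0], ![0, 1, 1], ![0, Complex.I, -Complex.I]] x p *
      ![![(1 : ℂ), 0, 0], ![0, 1, 1], ![0, Complex.I, -Complex.I]] y q *
      ![![(1 : ℂ), 0, 0], ![0, 1, 1], ![0, Complex.I, -Complex.I]] z r)]
  fin_cases x <;> fin_cases y <;> fin_cases z <;>
    simp only [Nat.reduceAdd, Fin.zero_eta, Fin.isValue, Fin.mk_one, Fin.reduceFinMk, Fin.reduceEq,
      ne_eq, not_true_eq_false, not_false_eq_true, and_false, and_true, and_self, or_self, or_false,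
      or_true, zero_ne_one, one_ne_zero, ↓reduceIte, one_div, Nat.succ_eq_add_one, Matrix.cons_val',
      Matrix.cons_val_zero, Matrix.cons_val_fin_one, Matrix.cons_val_one, Matrix.cons_val, mul_one,
      mul_zero, zero_mul, mul_neg, neg_mul, neg_zero, add_zero, zero_add, neg_add_cancel,
      add_neg_cancel] <;>
    norm_num [Complex.ext_iff]

/-- `R(T_cw,2^{⊠N}) ≤ R(u(0,1,1)^{⊠N})` for every `N` (restriction passes to Kronecker powers and
rank is monotone under restriction). [folklore] -/
theorem tensorRank_kroneckerPow_cwTwo_le_hessePointCW (N : ℕ) :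
    tensorRank (kroneckerPow (fun a b c : Fin 3 => if (a = 0 ∧ b = c ∧ b ≠ 0) ∨
        (b = 0 ∧ a = c ∧ a ≠ 0) ∨ (c = 0 ∧ a = b ∧ a ≠ 0) then (1 : ℂ) else 0) N) ≤
      tensorRank (kroneckerPow
        (fun x y z : Fin 3 => if x + y + z = 0 then ![(0 : ℂ), 1, 1] (y - x) else (0 : ℂ)) N) :=
  (hessePointCW_restrictsTo_cwTwo.kroneckerPow N).tensorRank_le

/-- **`HesseToCW`** (item stmt-MatrixMultiplication-4895 of route HessianPlane): flatness of the
asymptotic rank on the Hessian plane gives the CW-point growth bound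
`R(T_cw,2^{⊠N}) = O(3^{(1+ε)N})`, by specialising `HessianPlaneFlat` to `(a,b,c) = (0,1,1)` and
the restriction `u(0,1,1) ≥ T_cw,2`. [folklore] -/
theorem hesseToCW_proof :
    Summit.MatrixMultiplication.MatrixMultiplication.Theses.HessianPlane.HesseToCW := by
  unfold Summit.MatrixMultiplication.MatrixMultiplication.Theses.HessianPlane.HesseToCW
  intro hflat ε hε
  refine IsBigO.trans (isBigO_of_le _ fun N => ?_) (hflat 0 1 1 ε hε)
  rw [Real.norm_of_nonneg (Nat.cast_nonneg _), Real.norm_of_nonneg (Nat.cast_nonneg _)]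
  -- the goal's `∏`-form is `kroneckerPow T_cw,2 N` by `rfl`
  exact Nat.cast_le.mpr (tensorRank_kroneckerPow_cwTwo_le_hessePointCW N)

end Summit.MatrixMultiplication.MatrixMultiplication.Theorems

end
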